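import Summits.ABC.IUTFork.LDHGenuinePerImageLevelPoleL
import Summits.ABC.IUTFork.LDHGenuinePerImageShellUniform
import HarnessLib

/-!
# The fork at [IUTchIII] Corollary 3.12, L-DH level, READING (P): the UNIFORM POLE-`l` SHELL THEOREM, part 3 — the SHELL TEST UNIFORMLY IN
# THE PRIME `l ≥ L₀`, POLES OF ORDER `e_l ≥ 6` INCLUDED (abc-iut cell, crux ThetaPartII = stmt-ABC-19678; R-H round-4 census row O-18
# residual R-P, KEY R4O18-UPOLEL; family «C:PERIMAGE-LEVEL»; part 1 = `LDHGenuinePerImageLevelPoleL`, part 2 = `LDHGenuinePerImageUniformPoleL`)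

Record-only PROOF file (D-0012) of the abc-iut cell (seat abc-iut-L5-t8, gen 14). TAKES NO SIDE on [IUTchIII] Cor. 3.12.
`q ∈ ℚ ∖ {0, 1}`, `j(q) = N/∏_{p∈I} p^{e_p}` in lowest terms (`I` primes, `e_p ≥ 1`, `p ∤ N`). abc-iut-c312-d1's uniform shell test
`Cor22.cor312PerImageOf_ratPoint_shell_uniform` (`LDHGenuinePerImageShellUniform`, p494091) reads: ONE inequality at `L₀ ≥ 7`,
`(1/6)·Σ_{p∈I, p≠2} e_p·log p ≤ Σ_{p∈I, p≠2} (1 − 1/(L₀·k_p))·log p + ½·log 2 + [3∉I]·½·log 3 + [5∉I]·¾·log 5 + (1 − 1/(L₀−1))·log L₀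
   + Σ_{p∈Psh} (a_p − p^{a_p}/(L₀·k_p))·log p + log π`   (`k_p = lcm(30/gcd(30,e_p), c_p)`, shell poles `Psh ⊆ I ∖ {2}` with `p^{a_p} ≤ a_p·L₀·k_p`),
gives `T.Cor312PerImageOf` at every genuine Θ-volume datum `T` of `(q, l)` for every prime `l ≥ L₀` **that is not a pole**. THIS FILE lifts
the restriction «not a pole» for poles of order `e_l ≥ 6` (other than the shell poles themselves), BY NAME over c312-d1's ONE-`l` test `Cor22.cor312PerImageOf_ratPoint_shell`
(`LDHGenuinePerImageShellRat`, which allows `l ∈ I`) and part 1's dictionary `logQAvoid_ratPoint_two_prime_eq_sum_ne`: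

* **(T5) `Cor22.cor312PerImageOf_ratPoint_shell_uniform_poleL`** — p494091's hypotheses VERBATIM, and the conclusion for EVERY prime
  `l ≥ L₀` such that, IF `l ∈ I` is a pole, `e_l ≥ 6` and `l` is not itself one of the shell poles (automatic for `l > L₀`); `…AtDatum…`
  twin; p494091's landed certificates (`…UniformShellRows…`, shell poles `p ≤ L₀`) feed it unchanged. At a pole the
  `q`-side `log q^{∤2l}(q) = Σ_{p≠2} e_p·log p − e_l·log l` DROPS by `e_l·log l` while the weight side loses only the term
  `(1 − 1/(l·k_l))·log l ≤ log l` of the pole `l` (every other term is monotone in `l` exactly as in p494091); with `κ_l ≤ (l+1)/24` the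
  drop pays the loss as soon as `e_l ≥ 6`. Poles with `e_l ∈ {2, 4}` are NOT covered here (no landed test carries both the shell term and the
  pole-`l` wild weight `2 − 1/(l−1)` of ★ p539739); for them see part 2's slope line (T4) or the per-row instances of ★ p541073 / of the
  one-`l` shell test.

For the Frey–Legendre data of the cell's tables `e_l = 2·v_l(abc)`, so the pole clause reads `v_l(abc) ≥ 3`. SUBSUMPTION (said, not re-filed;
R101): per-row files stay the theorems of record; (T5) decides a tabulated `(q, l)` by ONE `exact` from ONE inequality per triple at a level
`L₀ ≤ l` (desk counts on the cell's STATUS line of this file). HONEST SCOPE: statements about OUR typed reading (P)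
(`Cor22.ThetaVolumeDatumAt.Cor312PerImageOf`, container (Ind2) = the tree's FULL lattice-automorphism indeterminacy) at rational data.
Nothing asserts that genuine Θ-data exist at these `(q, l)`, Cor. 3.12 in general or in print's reading, or abc; proved-as-typed ≠ in print;
located ≠ adjudicated. [cite: Mochizuki2012, IUTchI Def. 3.1 (a)(b)(c) p. 61–62; IUTchIII Cor. 3.12 p. 173–174, proof Step (x) p. 181;
IUTchIV Prop. 1.2 (i)(ii) p. 10, Thm. 1.10 p. 22–23, Step (ii) p. 24, Step (v) p. 27–29] [cite: DupuyHilado2025, §4.9, §4.12]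
[claim: Mochizuki2012, status: disputed] for every IUT quotation. PROOF-ONLY: no definitions, no new `Prop`, no instance, no notation.
-/

noncomputable section

open NumberField IsDedekindDomain Ideal Module

namespace Literature.IUT.LogVolume.Cor22

open Literature.NumberTheory.DiophantineGeometry.GenEll Summit.ABC.IUTFork Literature.IUT.HodgeTheaters
open Literature.NumberTheory.DiophantineGeometry.UniformABCConjecture

variable {q : ℚ} {N D : ℕ} {I : Finset ℕ} {e : ℕ → ℕ}

/-- `(1 − 1/(x−1))·log x` is monotone on `7 ≤ x` (p494091's private `lterm_mono`, re-derived). [folklore] -/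
private theorem lterm_mono_pl {L l : ℕ} (hL : 7 ≤ L) (hLl : L ≤ l) :
    (1 - ((L - 1 : ℕ) : ℝ)⁻¹) * Real.log L ≤ (1 - ((l - 1 : ℕ) : ℝ)⁻¹) * Real.log l := by
  have hL1 : (6 : ℝ) ≤ ((L - 1 : ℕ) : ℝ) := by
    have : 6 ≤ L - 1 := by omega
    exact_mod_cast this
  have hl1 : ((L - 1 : ℕ) : ℝ) ≤ ((l - 1 : ℕ) : ℝ) := by
    have : L - 1 ≤ l - 1 := by omega
    exact_mod_cast this
  have hLR : (7 : ℝ) ≤ L := by exact_mod_cast hL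
  have hlR : (L : ℝ) ≤ l := by exact_mod_cast hLl
  have hinv : ((l - 1 : ℕ) : ℝ)⁻¹ ≤ ((L - 1 : ℕ) : ℝ)⁻¹ := inv_anti₀ (by linarith) hl1
  have hinvL : ((L - 1 : ℕ) : ℝ)⁻¹ ≤ 6⁻¹ := inv_anti₀ (by norm_num) hL1
  have hlogL : 0 ≤ Real.log L := Real.log_nonneg (by linarith)
  have hlog : Real.log L ≤ Real.log l := Real.log_le_log (by linarith) hlR
  have h1 : 0 ≤ 1 - ((l - 1 : ℕ) : ℝ)⁻¹ := by linarith
  calc (1 - ((L - 1 : ℕ) : ℝ)⁻¹) * Real.log L ≤ (1 - ((l - 1 : ℕ) : ℝ)⁻¹) * Real.log L :=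
        mul_le_mul_of_nonneg_right (by linarith) hlogL
    _ ≤ (1 - ((l - 1 : ℕ) : ℝ)⁻¹) * Real.log l := mul_le_mul_of_nonneg_left hlog h1

/-- **(T5) RATIONAL POINTS, THE SHELL TEST UNIFORMLY IN THE PRIME `l ≥ L₀`, POLES OF ORDER `e_l ≥ 6` INCLUDED** (statement in words in
the module docstring): ONE inequality at `L₀ ≥ 7` (p494091's, shell poles `p ≤ L₀`) gives [IUTchIII] Cor. 3.12 in the cell's READING (P),
AS TYPED, at every genuine Θ-volume datum of `(q, l)` for EVERY prime `l ≥ L₀` such that, if `l` is a pole, `e_l ≥ 6` and `l ∉ Psh`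
(`l ∉ I`: p494091 verbatim; `l ∈ I`: the one-`l` shell test at `l`, the `q`-side drop `e_l·log l` paying the pole's weight `≤ log l`).
[cite: Mochizuki2012, IUTchIII Cor. 3.12
p. 173–174, proof Step (x) p. 181] [cite: Mochizuki2012, IUTchIV Prop. 1.2 (i)(ii) p. 10, Thm. 1.10 Step (ii) p. 24, Step (v) p. 27–29]
[claim: Mochizuki2012, status: disputed] -/
theorem cor312PerImageOf_ratPoint_shell_uniform_poleL (hq0 : q ≠ 0) (hq1 : q ≠ 1)
    (hI : ∀ p ∈ I, p.Prime) (he : ∀ p ∈ I, e p ≠ 0) (hD : D = ∏ p ∈ I, p ^ e p)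
    (hj : jInv q = (N : ℚ) / (D : ℚ)) (hN : N ≠ 0) (hcop : ∀ p ∈ I, ¬ p ∣ N)
    (L₀ : ℕ) (hL7 : 7 ≤ L₀)
    (Psh : Finset ℕ) (a : ℕ → ℕ) (hPshI : Psh ⊆ I) (hPsh2 : ∀ p ∈ Psh, p ≠ 2) (hPshL : ∀ p ∈ Psh, p ≤ L₀)
    (hapos : ∀ p ∈ Psh, (p : ℝ) ^ (a p) ≤
      (a p : ℝ) * ((L₀ * Nat.lcm (30 / Nat.gcd 30 (e p)) (if p = 3 then 2 else if p = 5 then 4 else 1) : ℕ) : ℝ))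
    (h : (1 / 6 : ℝ) * (∑ p ∈ I.filter (fun p => p ≠ 2), (e p : ℝ) * Real.log p) ≤
      (∑ p ∈ I.filter (fun p => p ≠ 2),
          (1 - ((L₀ * Nat.lcm (30 / Nat.gcd 30 (e p)) (if p = 3 then 2 else if p = 5 then 4 else 1) : ℕ) : ℝ)⁻¹) * Real.log p)
        + 2⁻¹ * Real.log 2
        + (if 3 ∈ I then 0 else 2⁻¹ * Real.log 3)
        + (if 5 ∈ I then 0 else (3 / 4 : ℝ) * Real.log 5)
        + (1 - ((L₀ - 1 : ℕ) : ℝ)⁻¹) * Real.log L₀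
        + (∑ p ∈ Psh, (((a p : ℕ) : ℝ) - (p : ℝ) ^ (a p) /
            ((L₀ * Nat.lcm (30 / Nat.gcd 30 (e p)) (if p = 3 then 2 else if p = 5 then 4 else 1) : ℕ) : ℝ)) * Real.log p)
        + Real.log Real.pi)
    {l : ℕ} (hl : l.Prime) (hLl : L₀ ≤ l) (hpole : l ∈ I → 6 ≤ e l ∧ l ∉ Psh) (T : ThetaVolumeDatumAt (ratPoint q) l) :
    T.Cor312PerImageOf := by
  classical
  by_cases hlI : l ∈ I
  swap
  · -- NOT a pole: p494091 verbatim
    exact cor312PerImageOf_ratPoint_shell_uniform hq0 hq1 hI he hD hj hN hcop L₀ hL7 Psh a hPshI hPsh2 hPshL hapos h hl hLl hlI T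
  -- `l ∈ I` IS A POLE of order `e_l ≥ 6`, not itself a shell pole
  obtain ⟨h6, hlP⟩ := hpole hlI
  have h7 : 7 ≤ l := le_trans hL7 hLl
  have hl2 : l ≠ 2 := by omega
  have hlR : (7 : ℝ) ≤ l := by exact_mod_cast h7
  have hlpos : (0 : ℝ) < l := by linarith
  have hL7R : (7 : ℝ) ≤ L₀ := by exact_mod_cast hL7
  have hLlR : (L₀ : ℝ) ≤ l := by exact_mod_cast hLl
  set k : ℕ → ℕ := fun p => Nat.lcm (30 / Nat.gcd 30 (e p)) (if p = 3 then 2 else if p = 5 then 4 else 1) with hk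
  have hkpos : ∀ p, 0 < k p := by
    intro p
    refine Nat.pos_of_ne_zero (Nat.lcm_ne_zero ?_ (by split_ifs <;> norm_num))
    exact (Nat.div_pos (Nat.le_of_dvd (by norm_num) (Nat.gcd_dvd_left 30 (e p))) (Nat.gcd_pos_of_pos_left _ (by norm_num))).ne'
  have hlogp : ∀ p ∈ I, 0 ≤ Real.log (p : ℝ) := fun p hp =>
    Real.log_nonneg (by exact_mod_cast (hI p hp).one_lt.le)
  -- the shell poles are admissible at `l`: `p ≠ 2`, `p ≠ l` (`l ∉ Psh`), `l ∤ p − 1` (`0 < p − 1 < p ≤ L₀ ≤ l`)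
  have hPsh : ∀ p ∈ Psh, p ≠ 2 ∧ p ≠ l ∧ ¬ l ∣ p - 1 := by
    intro p hpP
    have hpp := hI p (hPshI hpP)
    have hpL := hPshL p hpP
    have hpl : p ≠ l := fun h => hlP (h ▸ hpP)
    refine ⟨hPsh2 p hpP, hpl, fun hdvd => ?_⟩
    have hp3 : 3 ≤ p := by
      rcases hpp.eq_two_or_odd with h2 | hodd
      · exact absurd h2 (hPsh2 p hpP)
      · have := hpp.two_le; omega
    have := Nat.le_of_dvd (by omega) hdvd
    omega
  refine cor312PerImageOf_ratPoint_shell hq0 hq1 hl h7 hI he hD hj hN hcop Psh a hPshI hPsh ?_ T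
  rw [logQAvoid_ratPoint_two_prime_eq_sum_ne hI he hD hj hN hcop hl]
  -- split the two full sums at the pole `l`
  have hl2I : l ∈ I.filter (fun p => p ≠ 2) := Finset.mem_filter.mpr ⟨hlI, hl2⟩
  have hfilt : I.filter (fun p => p ≠ 2 ∧ p ≠ l) = (I.filter (fun p => p ≠ 2)).erase l := by
    ext p
    simp only [Finset.mem_filter, Finset.mem_erase]
    tauto
  have hQsplit : (∑ p ∈ I.filter (fun p => p ≠ 2), (e p : ℝ) * Real.log p) =
      (∑ p ∈ I.filter (fun p => p ≠ 2 ∧ p ≠ l), (e p : ℝ) * Real.log p) + (e l : ℝ) * Real.log l := by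
    rw [hfilt]
    exact (Finset.sum_erase_add _ _ hl2I).symm
  have hWsplit : (∑ p ∈ I.filter (fun p => p ≠ 2), (1 - ((l * k p : ℕ) : ℝ)⁻¹) * Real.log p) =
      (∑ p ∈ I.filter (fun p => p ≠ 2 ∧ p ≠ l), (1 - ((l * k p : ℕ) : ℝ)⁻¹) * Real.log p)
        + (1 - ((l * k l : ℕ) : ℝ)⁻¹) * Real.log l := by
    rw [hfilt]
    exact (Finset.sum_erase_add _ _ hl2I).symm
  -- (1) monotonicity of the weights `L₀ → l`, and the pole's own weight is `≤ log l`
  have hW : ∀ p ∈ I.filter (fun p => p ≠ 2),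
      (1 - ((L₀ * k p : ℕ) : ℝ)⁻¹) * Real.log p ≤ (1 - ((l * k p : ℕ) : ℝ)⁻¹) * Real.log p := by
    intro p hp
    have hkp : (0 : ℝ) < k p := by exact_mod_cast hkpos p
    have h1 : ((L₀ * k p : ℕ) : ℝ) ≤ ((l * k p : ℕ) : ℝ) := by exact_mod_cast Nat.mul_le_mul_right _ hLl
    have h0 : (0 : ℝ) < ((L₀ * k p : ℕ) : ℝ) := by push_cast; positivity
    have hinv := inv_anti₀ h0 h1
    exact mul_le_mul_of_nonneg_right (by linarith) (hlogp p (Finset.mem_filter.mp hp).1)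
  have hWsum := Finset.sum_le_sum hW
  have hWl : (1 - ((l * k l : ℕ) : ℝ)⁻¹) * Real.log l ≤ Real.log l := by
    have h0 : (0 : ℝ) ≤ ((l * k l : ℕ) : ℝ)⁻¹ := by positivity
    have hlogl : 0 ≤ Real.log l := Real.log_nonneg (by linarith)
    nlinarith
  -- (2) monotonicity of the shell terms, and their nonnegativity at `L₀`
  have hS : ∀ p ∈ Psh,
      (((a p : ℕ) : ℝ) - (p : ℝ) ^ (a p) / ((L₀ * k p : ℕ) : ℝ)) * Real.log p ≤
        (((a p : ℕ) : ℝ) - (p : ℝ) ^ (a p) / ((l * k p : ℕ) : ℝ)) * Real.log p := by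
    intro p hp
    have hkp : (0 : ℝ) < k p := by exact_mod_cast hkpos p
    have h1 : ((L₀ * k p : ℕ) : ℝ) ≤ ((l * k p : ℕ) : ℝ) := by exact_mod_cast Nat.mul_le_mul_right _ hLl
    have h0 : (0 : ℝ) < ((L₀ * k p : ℕ) : ℝ) := by push_cast; positivity
    have hdiv := div_le_div_of_nonneg_left (by positivity : (0 : ℝ) ≤ (p : ℝ) ^ (a p)) h0 h1
    exact mul_le_mul_of_nonneg_right (by linarith) (hlogp p (hPshI hp))
  have hSsum := Finset.sum_le_sum hS
  have hS0 : 0 ≤ ∑ p ∈ Psh, (((a p : ℕ) : ℝ) - (p : ℝ) ^ (a p) / ((L₀ * k p : ℕ) : ℝ)) * Real.log p := by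
    refine Finset.sum_nonneg fun p hp => ?_
    have hkp : (0 : ℝ) < k p := by exact_mod_cast hkpos p
    have h0 : (0 : ℝ) < ((L₀ * k p : ℕ) : ℝ) := by push_cast; positivity
    have hle : (p : ℝ) ^ (a p) / ((L₀ * k p : ℕ) : ℝ) ≤ (a p : ℝ) := by
      rw [div_le_iff₀ h0]
      exact hapos p hp
    exact mul_nonneg (by push_cast at hle ⊢; linarith) (hlogp p (hPshI hp))
  -- (3) the `l`-term, the constants
  have hLt := lterm_mono_pl hL7 hLl
  have hpi : 0 < Real.log Real.pi := Real.log_pos (by linarith [Real.pi_gt_three])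
  have hlogl : 0 ≤ Real.log l := Real.log_nonneg (by linarith)
  have hX0 : 0 ≤ ∑ p ∈ I.filter (fun p => p ≠ 2 ∧ p ≠ l), (e p : ℝ) * Real.log p :=
    Finset.sum_nonneg fun p hp => mul_nonneg (Nat.cast_nonneg _) (hlogp p (Finset.mem_filter.mp hp).1)
  have h6R : (6 : ℝ) ≤ e l := by exact_mod_cast h6
  -- (4) the unscaled inequality at `l`, the pole moved to the `q`-side:
  --     `X/6 ≤ W_l + ½log2 + c3 + c5 + Λ_l + Sh_l + log π + (1 − e_l/6)·log l`
  have hkey : (1 / 6 : ℝ) * (∑ p ∈ I.filter (fun p => p ≠ 2 ∧ p ≠ l), (e p : ℝ) * Real.log p) ≤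
      (∑ p ∈ I.filter (fun p => p ≠ 2 ∧ p ≠ l), (1 - ((l * k p : ℕ) : ℝ)⁻¹) * Real.log p)
        + 2⁻¹ * Real.log 2
        + (if 3 ∈ I then 0 else 2⁻¹ * Real.log 3)
        + (if 5 ∈ I then 0 else (3 / 4 : ℝ) * Real.log 5)
        + (1 - ((l - 1 : ℕ) : ℝ)⁻¹) * Real.log l
        + (∑ p ∈ Psh, (((a p : ℕ) : ℝ) - (p : ℝ) ^ (a p) / ((l * k p : ℕ) : ℝ)) * Real.log p)
        + Real.log Real.pi
        + (1 - (e l : ℝ) / 6) * Real.log l := by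
    rw [hQsplit] at h
    rw [hWsplit] at hWsum
    nlinarith [h, hWsum, hWl, hSsum, hLt, h6R, hlogl]
  have hdrop : (1 - (e l : ℝ) / 6) * Real.log l ≤ 0 := by nlinarith [h6R, hlogl]
  have hShl : 0 ≤ ∑ p ∈ Psh, (((a p : ℕ) : ℝ) - (p : ℝ) ^ (a p) / ((l * k p : ℕ) : ℝ)) * Real.log p :=
    hS0.trans hSsum
  -- (5) scale by `(l+1)/4 = (l+5)/4 − 1`; `κ_l ≤ (l+1)/24`; `(l+5)/4 ≥ (l+1)/4` on the nonnegative shell and `log π`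
  have hl1 : (0 : ℝ) ≤ ((l : ℝ) + 1) / 4 := by positivity
  have h1 : (((l : ℝ) + 1) / 24 - 1 / (2 * l)) * (∑ p ∈ I.filter (fun p => p ≠ 2 ∧ p ≠ l), (e p : ℝ) * Real.log p) ≤
      ((l : ℝ) + 1) / 24 * (∑ p ∈ I.filter (fun p => p ≠ 2 ∧ p ≠ l), (e p : ℝ) * Real.log p) := by
    have h0 : 0 ≤ 1 / (2 * (l : ℝ)) * (∑ p ∈ I.filter (fun p => p ≠ 2 ∧ p ≠ l), (e p : ℝ) * Real.log p) := by
      positivity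
    rw [sub_mul]
    linarith
  have h2 := mul_le_mul_of_nonneg_left hkey hl1
  have h3 := mul_le_mul_of_nonneg_left hdrop hl1
  linarith [h1, h2, h3, hShl, hpi]

/-- **(T5) in both readings at the Θ-data of `(q, l)`**: `Cor312PerImageAtDatum ∧ Cor312AtDatum` at every prime `l ≥ L₀` under the
uniform shell test with the pole clause `e_l ≥ 6 ∧ l ∉ Psh`. [cite: Mochizuki2012, IUTchIII Cor. 3.12 p. 173–174] [claim: Mochizuki2012, status: disputed] -/
theorem cor312PerImageAtDatum_ratPoint_shell_uniform_poleL (hq0 : q ≠ 0) (hq1 : q ≠ 1)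
    (hI : ∀ p ∈ I, p.Prime) (he : ∀ p ∈ I, e p ≠ 0) (hD : D = ∏ p ∈ I, p ^ e p)
    (hj : jInv q = (N : ℚ) / (D : ℚ)) (hN : N ≠ 0) (hcop : ∀ p ∈ I, ¬ p ∣ N)
    (L₀ : ℕ) (hL7 : 7 ≤ L₀)
    (Psh : Finset ℕ) (a : ℕ → ℕ) (hPshI : Psh ⊆ I) (hPsh2 : ∀ p ∈ Psh, p ≠ 2) (hPshL : ∀ p ∈ Psh, p ≤ L₀)
    (hapos : ∀ p ∈ Psh, (p : ℝ) ^ (a p) ≤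
      (a p : ℝ) * ((L₀ * Nat.lcm (30 / Nat.gcd 30 (e p)) (if p = 3 then 2 else if p = 5 then 4 else 1) : ℕ) : ℝ))
    (h : (1 / 6 : ℝ) * (∑ p ∈ I.filter (fun p => p ≠ 2), (e p : ℝ) * Real.log p) ≤
      (∑ p ∈ I.filter (fun p => p ≠ 2),
          (1 - ((L₀ * Nat.lcm (30 / Nat.gcd 30 (e p)) (if p = 3 then 2 else if p = 5 then 4 else 1) : ℕ) : ℝ)⁻¹) * Real.log p)
        + 2⁻¹ * Real.log 2
        + (if 3 ∈ I then 0 else 2⁻¹ * Real.log 3)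
        + (if 5 ∈ I then 0 else (3 / 4 : ℝ) * Real.log 5)
        + (1 - ((L₀ - 1 : ℕ) : ℝ)⁻¹) * Real.log L₀
        + (∑ p ∈ Psh, (((a p : ℕ) : ℝ) - (p : ℝ) ^ (a p) /
            ((L₀ * Nat.lcm (30 / Nat.gcd 30 (e p)) (if p = 3 then 2 else if p = 5 then 4 else 1) : ℕ) : ℝ)) * Real.log p)
        + Real.log Real.pi)
    {l : ℕ} (hl : l.Prime) (hLl : L₀ ≤ l) (hpole : l ∈ I → 6 ≤ e l ∧ l ∉ Psh) :
    Cor312PerImageAtDatum (ratPoint q) l ∧ Cor312AtDatum (ratPoint q) l :=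
  have h' : Cor312PerImageAtDatum (ratPoint q) l := fun T =>
    cor312PerImageOf_ratPoint_shell_uniform_poleL hq0 hq1 hI he hD hj hN hcop L₀ hL7 Psh a hPshI hPsh2 hPshL hapos h hl hLl hpole T
  ⟨h', cor312AtDatum_of_perImage h'⟩

end Literature.IUT.LogVolume.Cor22

end
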